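import Mathlib
import HarnessLib

/-!
# Item `LrcModEntire` (stmt-NavierStokesRegularity-20428), skeleton twist_split v6, CLASS road to `stub_twistingTHGerm` —
# the ENDGAME of the plane-oscillation law (OSC): the Dini–Grönwall growth bound and the «K < 1/2» threshold against the Type-I datum

Cell ns-regularity-ideate, seat ns-k2-port-2 g3 (sequel of `…TwistingTHPlaneOscillation` / `…Envelope`; `--supports stmt-NavierStokesRegularity-20428
--as helper`).  LEAD memo NORMALFORM-TH-g12 §6 / CENSUS-20428-g12 §3: the plane oscillation `O ≥ 0` of the Clebsch weight is an ancient subsolution of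
`∂ₜO + ½∂_z(S·O) ≤ ∂_zzO` with `|S_z| ≤ 2K/(−t)`; by the maximum principle its supremum `m(t) = sup_z O(t,z)` can grow at most at the rate of the
compression, `D⁺m ≤ (K/(−t))·m`, hence `m(t₁) ≤ m(t₀)·(t₀/t₁)^K`, to be played against the Type-I datum `m(t₀) ≲ (−t₀)^{−1/2}` — «conclusive only if
K < 1/2».  This file is that endgame, as pure one-variable real analysis (no PDE):

* `le_mul_rpow_of_dini` — **Dini–Grönwall with the critical rate**: `m` continuous on `[t₀,t₁] ⊂ (−∞,0)`, `m(t₀) ≥ 0`, and the right lower Dini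
  bound `D₊m(t) ≤ (K/(−t))·m(t)` (in the `liminf`-slope form of Mathlib's boundary comparison lemmas) ⇒ `m(t₁) ≤ m(t₀)·(t₀/t₁)^K`.
* `eq_zero_of_dini_of_typeI` — **the threshold**: if moreover `0 ≤ m(t) ≤ c·(−t)^{−1/2}` for all `t < 0` and `K < 1/2`, then `m ≡ 0` on `(−∞,0)`
  (let `t₀ → −∞`: `m(t₁) ≤ c(−t₁)^{−K}(−t₀)^{K−1/2} → 0`).  At `K = 1/2` the bound is `c(−t₁)^{−1/2}` — exactly the datum, no gain: the wall.

WHAT THIS IS NOT: not a claim about Navier–Stokes regularity and not the stub — the arithmetic of the located obstruction, by name, so that the CLASS road's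
remaining analytic input is exactly «attainment/regularity of the plane extrema + the Dini inequality for `sup_z O` with a compression constant K < 1/2»
(bears_on LADDER-NS N0, item 20428 / crux 19708).
-/

noncomputable section

-- the summit and its single sub-problem share the name (CONVENTIONS §1), as in every Theorems file
set_option linter.dupNamespace false

namespace Summit.NavierStokesRegularity.NavierStokesRegularity.Theorems.PoloidalWindowDoorLrcModEntireTwistingTHPlaneOscillationEndgame

open Set Filter Topology

/-! ### The comparison function `B(t) = A·(t₀/t)^p` on `(−∞, 0)` -/

/-- For `t₀ ≤ t < 0` the ratio `t₀/t` is `≥ 1` (in particular positive). -/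
theorem one_le_div_of_le_neg {t₀ t : ℝ} (h : t₀ ≤ t) (ht : t < 0) : 1 ≤ t₀ / t := by
  rw [le_div_iff_of_neg ht]; linarith

/-- Derivative of the comparison function: `d/dt [A·(t₀/t)^p] = A·(p/(−t))·(t₀/t)^p` for `t < 0`, `t₀ < 0`. -/
theorem hasDerivAt_compare {A p t₀ t : ℝ} (ht₀ : t₀ < 0) (ht : t < 0) :
    HasDerivAt (fun s : ℝ => A * (t₀ / s) ^ p) (A * (p / (-t)) * (t₀ / t) ^ p) t := by
  have htne : t ≠ 0 := ht.ne
  have hq : HasDerivAt (fun s : ℝ => t₀ / s) (-t₀ / t ^ 2) t := by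
    have h := (hasDerivAt_inv htne).const_mul t₀
    have e : (fun s : ℝ => t₀ * s⁻¹) = fun s => t₀ / s := by funext s; rw [div_eq_mul_inv]
    rw [e] at h
    refine h.congr_deriv ?_
    field_simp
  have hq0 : 0 < t₀ / t := div_pos_of_neg_of_neg ht₀ ht
  have hr := (hq.rpow_const (p := p) (Or.inl hq0.ne')).const_mul A
  refine hr.congr_deriv ?_
  -- `A * ((−t₀/t²) * p * (t₀/t)^(p−1)) = A * (p/(−t)) * (t₀/t)^p`
  have e1 : (t₀ / t) ^ p = (t₀ / t) ^ (p - 1) * (t₀ / t) := by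
    rw [← Real.rpow_add_one hq0.ne' (p - 1)]; ring_nf
  rw [e1]
  field_simp

/-! ### Dini–Grönwall with the critical rate -/

/-- **Dini–Grönwall with the rate `K/(−t)`.**  Let `m` be continuous on `[t₀, t₁] ⊂ (−∞,0)` with `m(t₀) ≥ 0`, and suppose the right lower Dini
derivative of `m` is at most `(K/(−t))·m(t)` on `[t₀,t₁)`, in the form: for every `r > (K/(−t))·m(t)` the slopes `(m(z) − m(t))/(z − t)` are `< r`
frequently as `z ↓ t` (the hypothesis shape of Mathlib's `image_le_of_liminf_slope_right_lt_deriv_boundary'`).  Then `m(t₁) ≤ m(t₀)·(t₀/t₁)^K`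
(any real `K`). -/
theorem le_mul_rpow_of_dini {m : ℝ → ℝ} {K t₀ t₁ : ℝ} (h01 : t₀ ≤ t₁) (h1 : t₁ < 0)
    (hmc : ContinuousOn m (Icc t₀ t₁)) (hm0 : 0 ≤ m t₀)
    (hdini : ∀ t ∈ Ico t₀ t₁, ∀ r : ℝ, K / (-t) * m t < r → ∃ᶠ z in 𝓝[>] t, slope m t z < r) :
    m t₁ ≤ m t₀ * (t₀ / t₁) ^ K := by
  have h0 : t₀ < 0 := lt_of_le_of_lt h01 h1
  -- for every `ε > 0`: comparison with `B_ε(t) = (m t₀ + ε)·(t₀/t)^(K+ε)`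
  have hε : ∀ ε : ℝ, 0 < ε → m t₁ ≤ (m t₀ + ε) * (t₀ / t₁) ^ (K + ε) := by
    intro ε hε
    set B : ℝ → ℝ := fun s => (m t₀ + ε) * (t₀ / s) ^ (K + ε) with hB
    set B' : ℝ → ℝ := fun s => (m t₀ + ε) * ((K + ε) / (-s)) * (t₀ / s) ^ (K + ε) with hB'
    have hBd : ∀ s ∈ Ico t₀ t₁, HasDerivAt B (B' s) s := fun s hs =>
      hasDerivAt_compare h0 (lt_of_lt_of_le hs.2 h1.le)
    have hBc : ContinuousOn B (Icc t₀ t₁) := by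
      intro s hs
      have hs0 : s < 0 := lt_of_le_of_lt hs.2 h1
      exact (hasDerivAt_compare (A := m t₀ + ε) (p := K + ε) h0 hs0).continuousAt.continuousWithinAt
    have ha : m t₀ ≤ B t₀ := by
      simp only [hB, div_self h0.ne, Real.one_rpow, mul_one]
      linarith
    have hbound : ∀ s ∈ Ico t₀ t₁, m s = B s → K / (-s) * m s < B' s := by
      intro s hs heq
      have hs0 : s < 0 := lt_of_lt_of_le hs.2 h1.le
      have hq : 0 < (t₀ / s) ^ (K + ε) := Real.rpow_pos_of_pos (div_pos_of_neg_of_neg h0 hs0) _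
      have hBpos : 0 < B s := by rw [hB]; exact mul_pos (by linarith) hq
      rw [heq, hB']
      have hs' : 0 < -s := by linarith
      have e : K / (-s) * B s = (m t₀ + ε) * (K / (-s)) * (t₀ / s) ^ (K + ε) := by rw [hB]; ring
      rw [e]
      have hlt : K / (-s) < (K + ε) / (-s) := by
        rw [div_lt_div_iff_of_pos_right hs']; linarith
      have hA : 0 < m t₀ + ε := by linarith
      nlinarith [mul_pos hA hq, hlt]
    have h := image_le_of_liminf_slope_right_lt_deriv_boundary' (f' := fun s => K / (-s) * m s) hmc hdini ha hBc
      (fun s hs => (hBd s hs).hasDerivWithinAt) hbound (right_mem_Icc.2 h01)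
    simpa [hB] using h
  -- let `ε → 0⁺`
  have hq1 : 0 < t₀ / t₁ := div_pos_of_neg_of_neg h0 h1
  have hlim : Tendsto (fun ε : ℝ => (m t₀ + ε) * (t₀ / t₁) ^ (K + ε)) (𝓝[>] 0) (𝓝 (m t₀ * (t₀ / t₁) ^ K)) := by
    have h1' : Tendsto (fun ε : ℝ => m t₀ + ε) (𝓝 0) (𝓝 (m t₀)) := by
      have hc : Continuous (fun ε : ℝ => m t₀ + ε) := by fun_prop
      simpa using hc.tendsto 0
    have h2' : Tendsto (fun ε : ℝ => (t₀ / t₁) ^ (K + ε)) (𝓝 0) (𝓝 ((t₀ / t₁) ^ K)) := by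
      have hK' : Tendsto (fun ε : ℝ => K + ε) (𝓝 0) (𝓝 K) := by
        have hc2 : Continuous (fun ε : ℝ => K + ε) := by fun_prop
        simpa using hc2.tendsto 0
      have hc : ContinuousAt (fun p : ℝ => (t₀ / t₁) ^ p) K := Real.continuousAt_const_rpow hq1.ne'
      exact hc.tendsto.comp hK'
    exact (h1'.mul h2').mono_left nhdsWithin_le_nhds
  refine ge_of_tendsto hlim ?_
  filter_upwards [self_mem_nhdsWithin] with ε hε0
  exact hε ε hε0

/-! ### The threshold `K < 1/2` against the Type-I datum -/

/-- **THE «K < 1/2» ENDGAME.**  Let `m ≥ 0` be continuous on `(−∞,0)` with the Dini bound `D₊m(t) ≤ (K/(−t))·m(t)` for every `t < 0` and the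
Type-I datum `m(t) ≤ c·(−t)^(−1/2)`.  If `K < 1/2` then `m ≡ 0` on `(−∞, 0)`:  `m(t₁) ≤ m(t₀)(t₀/t₁)^K ≤ c(−t₁)^{−K}(−t₀)^{K−1/2} → 0` as
`t₀ → −∞`.  (For `K ≥ 1/2` the right side does not tend to `0`: the located wall of the class road.) -/
theorem eq_zero_of_dini_of_typeI {m : ℝ → ℝ} {K c : ℝ} (hK2 : K < 1 / 2)
    (hmc : ContinuousOn m (Iio 0)) (hm0 : ∀ t < 0, 0 ≤ m t)
    (hdini : ∀ t < 0, ∀ r : ℝ, K / (-t) * m t < r → ∃ᶠ z in 𝓝[>] t, slope m t z < r)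
    (hdatum : ∀ t < 0, m t ≤ c * (-t) ^ (-(1 / 2 : ℝ))) :
    ∀ t < 0, m t = 0 := by
  intro t₁ h1
  -- the growth bound from any earlier time
  have hgrow : ∀ t₀ ≤ t₁, m t₁ ≤ c * (-t₁) ^ (-K) * (-t₀) ^ (K - 1 / 2) := by
    intro t₀ h01
    have h0 : t₀ < 0 := lt_of_le_of_lt h01 h1
    have hmc' : ContinuousOn m (Icc t₀ t₁) := hmc.mono fun s hs => lt_of_le_of_lt hs.2 h1
    have hG := le_mul_rpow_of_dini h01 h1 hmc' (hm0 t₀ h0) fun t ht => hdini t (lt_of_lt_of_le ht.2 h1.le)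
    have hq : 0 ≤ (t₀ / t₁) ^ K := Real.rpow_nonneg (div_pos_of_neg_of_neg h0 h1).le _
    have h2 : m t₁ ≤ c * (-t₀) ^ (-(1 / 2 : ℝ)) * (t₀ / t₁) ^ K :=
      hG.trans (mul_le_mul_of_nonneg_right (hdatum t₀ h0) hq)
    -- rewrite `(t₀/t₁)^K = (−t₀)^K · (−t₁)^(−K)` and combine the powers of `−t₀`
    have hn0 : 0 < -t₀ := by linarith
    have hn1 : 0 < -t₁ := by linarith
    have e1 : (t₀ / t₁) ^ K = (-t₀) ^ K * (-t₁) ^ (-K) := by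
      rw [show t₀ / t₁ = (-t₀) / (-t₁) by rw [neg_div_neg_eq], Real.div_rpow hn0.le hn1.le,
        Real.rpow_neg hn1.le, div_eq_mul_inv]
    have e2 : (-t₀) ^ (-(1 / 2 : ℝ)) * (-t₀) ^ K = (-t₀) ^ (K - 1 / 2) := by
      rw [← Real.rpow_add hn0]; ring_nf
    calc m t₁ ≤ c * (-t₀) ^ (-(1 / 2 : ℝ)) * (t₀ / t₁) ^ K := h2
      _ = c * (-t₁) ^ (-K) * ((-t₀) ^ (-(1 / 2 : ℝ)) * (-t₀) ^ K) := by rw [e1]; ring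
      _ = c * (-t₁) ^ (-K) * (-t₀) ^ (K - 1 / 2) := by rw [e2]
  -- let `t₀ → −∞`: `(−t₀)^(K − 1/2) → 0`
  have hexp : 0 < 1 / 2 - K := by linarith
  have hlim0 : Tendsto (fun t₀ : ℝ => (-t₀) ^ (K - 1 / 2)) atBot (𝓝 0) := by
    have h := (tendsto_rpow_neg_atTop hexp).comp tendsto_neg_atBot_atTop
    refine h.congr' (Eventually.of_forall fun t₀ => ?_)
    simp only [Function.comp_apply]
    congr 1; ring
  have hlim : Tendsto (fun t₀ : ℝ => c * (-t₁) ^ (-K) * (-t₀) ^ (K - 1 / 2)) atBot (𝓝 0) := by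
    simpa using hlim0.const_mul (c * (-t₁) ^ (-K))
  have hle : m t₁ ≤ 0 :=
    ge_of_tendsto hlim (eventually_atBot.2 ⟨t₁, fun t₀ h => hgrow t₀ h⟩)
  exact le_antisymm hle (hm0 t₁ h1)

end Summit.NavierStokesRegularity.NavierStokesRegularity.Theorems.PoloidalWindowDoorLrcModEntireTwistingTHPlaneOscillationEndgame
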